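import Mathlib
import Summits.MatrixMultiplication.MatrixMultiplication.Theorems.AutomaticSTPPDesignsAutomaticPackingThesisNormalForm
import Summits.MatrixMultiplication.MatrixMultiplication.Theorems.AutomaticSTPPDesignsAutomaticPackingThesisStubPowFamily
import Summits.MatrixMultiplication.MatrixMultiplication.Theorems.AutomaticSTPPDesignsAutomaticPackingThesisStubTypeCount
import Summits.MatrixMultiplication.MatrixMultiplication.Theorems.AutomaticSTPPDesignsAutomaticPackingThesisStubExpBeatsPoly
import Summits.MatrixMultiplication.MatrixMultiplication.Theorems.AutomaticSTPPDesignsAutomaticPackingThesisStubTripleConcat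
import Summits.MatrixMultiplication.MatrixMultiplication.Theorems.AutomaticSTPPDesignsAutomaticDesignBelowFourFifthsPacking

/-!
# `AutomaticPackingThesis` — the UNIFORM normal form (crux ⟺ beating packings of uniform triples)

Route `MatrixMultiplication/AutomaticSTPPDesigns`, crux `stmt-MatrixMultiplication-7356`
(`AutomaticPackingThesis`), line `Sketch`, registered stub `stub_uniformNormalForm` (lead c2, cycle 3).
Support file (`--supports`): it does not close the crux; it sharpens the finite cyclic normal form
(`automaticPackingThesis_iff_cyclicBeat`, file `…NormalForm.lean`) to UNIFORM designs.

Main result `stub_uniformNormalForm` / `automaticPackingThesis_iff_uniformBeat`: the crux holds iff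
for every `τ > 2/3` some STPP design `(Aᵢ, Bᵢ, Cᵢ)_{i<n}` in some `ℤ/(p^K)` (`p ≥ 2`) ALL of whose
`3n` blocks have the same size `M ≥ 2` beats its host, `p^K < n · (M³)^τ`; equivalently
(`uniformBeat_efficiency`) packs `n` uniform TPP triples with packing efficiency
`η = n M² / p^K > M^(2-3τ)`. So the crux is exactly: for every `δ > 0` some cyclic group packs
`M`-uniform TPP triples with efficiency `> M^(-δ)` — the packing-bound statement with every
inessential feature (automata, scales, bases, size profiles) stripped.

Proof of `→` (the content): a beating design with `n` triples and ratio `r > 1` has `m`-th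
concatenation powers (`stub_powFamily`, blocks indexed by words `w : Fin m → Fin n`, sizes the
products along the word) with packing sum `(r p^K)^m`; the words carry at most `(m+1)^n` size
profiles (`stub_typeCount`), so for `r^m > (m+1)^n` (`stub_expBeatsPoly`) one profile class alone
beats `p^(K m)` (pigeonhole) — a beating design with ONE size profile `(a, b, c)`; concatenating it
with its two role rotations `(B, C, A)`, `(C, A, B)` (`stub_tripleConcat`, rotation invariance of the
STPP) gives all `3 n'³` blocks the size `abc`. `M ≥ 2` because singleton designs obey `n ≤ p^K`
(packing bound). `←` is trivial.

## References

* H. Cohn, R. Kleinberg, B. Szegedy, C. Umans, *Group-theoretic algorithms for matrix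
  multiplication*, FOCS 2005, arXiv:math/0511460: Def. 5.1 (STPP), Lemma 5.4, Thm. 5.5.
* J. Blasiak, T. Church, H. Cohn, J. A. Grochow, E. Naslund, W. F. Sawin, C. Umans, *On cap sets and
  the group-theoretic approach to matrix multiplication*, Discrete Analysis 2017:3, §2 (packing
  bounds) and proof of Lemma 3.5 (grouping tensor-power words by type).
-/

-- single-conjunct summit: the mandated namespace repeats `MatrixMultiplication`.
set_option linter.dupNamespace false

noncomputable section

namespace Summit.MatrixMultiplication.MatrixMultiplication.Theorems

namespace AutomaticPackingThesis

open Finset Literature.Combinatorics.Additive Literature.Computability.AlgebraicComplexity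
open Summit.MatrixMultiplication.MatrixMultiplication.Theses.AutomaticSTPPDesigns

/-! ### Rotation and the one-profile reduction -/

/-- The one-clause STPP (`IsSTPP`) is invariant under the cyclic rotation of roles
`(A, B, C) ↦ (B, C, A)` (CKSU Def. 5.1 is visibly cyclic; tree: `AutomaticDesignBelowFourFifths.rotate`
for `AddSimultaneousTPP`). [cite: CohnKleinbergSzegedyUmans2005, Def. 5.1] -/
theorem isSTPP_rotate {H : Type*} [AddCommGroup H] {n : ℕ} {A B C : Fin n → Finset H}
    (h : IsSTPP A B C) : IsSTPP B C A :=
  (isSTPP_iff_addSimultaneousTPP _ _ _).2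
    (AutomaticDesignBelowFourFifths.rotate ((isSTPP_iff_addSimultaneousTPP _ _ _).1 h))

/-- The packing sum of the `m`-th concatenation power, written over words: with block sizes the
products along the word, `∑_w (|A_w||B_w||C_w|)^τ = (∑ᵢ (|Aᵢ||Bᵢ||Cᵢ|)^τ)^m`. [folklore] -/
theorem sum_words_rpow_eq_pow {n m : ℕ} (a b c : Fin n → ℕ) (τ : ℝ) :
    ∑ w : Fin m → Fin n, (((∏ t, a (w t)) * (∏ t, b (w t)) * (∏ t, c (w t)) : ℕ) : ℝ) ^ τ =
      (∑ i, ((a i * b i * c i : ℕ) : ℝ) ^ τ) ^ m := by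
  have hterm : ∀ w : Fin m → Fin n,
      (((∏ t, a (w t)) * (∏ t, b (w t)) * (∏ t, c (w t)) : ℕ) : ℝ) ^ τ =
        ∏ t, ((a (w t) * b (w t) * c (w t) : ℕ) : ℝ) ^ τ := by
    intro w
    rw [Real.finsetProd_rpow _ _ (fun t _ => Nat.cast_nonneg _)]
    congr 1
    push_cast
    rw [← Finset.prod_mul_distrib, ← Finset.prod_mul_distrib]
  simp only [hterm]
  rw [Finset.sum_pow', Fintype.piFinset_univ]

/-- **One size profile suffices.** A finite STPP design in `ℤ/(p^K)` beating its host at exponent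
`τ` yields one in some `ℤ/(p^K')` beating its host at the same exponent all of whose triples have
the SAME size profile `(|Aᵢ|, |Bᵢ|, |Cᵢ|) = (a, b, c)`: group the blocks of a high concatenation
power (`stub_powFamily`) by size profile — at most `(m+1)^n` classes (`stub_typeCount`) against a
packing ratio `r^m` (`stub_expBeatsPoly`) — and keep the heaviest class (pigeonhole); a sub-family
of an STPP family is one. [folklore] -/
theorem exists_oneProfile_of_beat (p K n : ℕ) (hp : 0 < p) (A B C : Fin n → Finset (ZMod (p ^ K)))
    (hS : IsSTPP A B C) (τ : ℝ)
    (hbeat : (p : ℝ) ^ K < ∑ i, (((A i).card * (B i).card * (C i).card : ℕ) : ℝ) ^ τ) :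
    ∃ (K' n' a b c : ℕ) (A' B' C' : Fin n' → Finset (ZMod (p ^ K'))),
      IsSTPP A' B' C' ∧ (∀ i, (A' i).card = a ∧ (B' i).card = b ∧ (C' i).card = c) ∧
        (p : ℝ) ^ K' < n' * ((a * b * c : ℕ) : ℝ) ^ τ := by
  classical
  -- the packing sum and its ratio
  set P : ℝ := (p : ℝ) ^ K with hP
  set S : ℝ := ∑ i, (((A i).card * (B i).card * (C i).card : ℕ) : ℝ) ^ τ with hSdef
  have hP0 : 0 < P := by positivity
  have hr : 1 < S / P := by rwa [one_lt_div hP0]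
  obtain ⟨m, hm⟩ := stub_expBeatsPoly (S / P) hr n 1
  rw [one_mul] at hm
  -- the `m`-th concatenation power, indexed by words
  obtain ⟨Am, Bm, Cm, hSm, hcard⟩ := stub_powFamily p K n hp A B C hS m
  set a : Fin n → ℕ := fun i => (A i).card with ha
  set b : Fin n → ℕ := fun i => (B i).card with hb
  set c : Fin n → ℕ := fun i => (C i).card with hc
  set F : (Fin m → Fin n) → ℝ := fun w =>
    (((Am w).card * (Bm w).card * (Cm w).card : ℕ) : ℝ) ^ τ with hF
  set prof : (Fin m → Fin n) → ℕ × ℕ × ℕ := fun w =>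
    (∏ t, a (w t), ∏ t, b (w t), ∏ t, c (w t)) with hprof
  set T : Finset (ℕ × ℕ × ℕ) := univ.image prof with hT
  have hsumF : ∑ w, F w = S ^ m := by
    have : ∀ w, F w = (((∏ t, a (w t)) * (∏ t, b (w t)) * (∏ t, c (w t)) : ℕ) : ℝ) ^ τ := by
      intro w
      simp only [hF, (hcard w).1, (hcard w).2.1, (hcard w).2.2, ha, hb, hc]
    simp only [this]
    rw [sum_words_rpow_eq_pow]
  have hTcard : T.card ≤ (m + 1) ^ n := stub_typeCount n m a b c
  -- `n ≥ 1` (else nothing beats), so words exist and `T` is nonempty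
  have hn : 0 < n := by
    rcases Nat.eq_zero_or_pos n with h0 | h0
    · subst h0
      simp [hSdef] at hbeat
      exact absurd hbeat (not_lt.2 hP0.le)
    · exact h0
  haveI : Nonempty (Fin m → Fin n) := ⟨fun _ => ⟨0, hn⟩⟩
  have hTne : T.Nonempty := by
    rw [hT]
    exact (univ_nonempty.image prof)
  have hTpos : (0 : ℝ) < T.card := by exact_mod_cast hTne.card_pos
  -- pigeonhole over profile classes
  obtain ⟨y, hyT, hy⟩ := exists_le_sum_fiber_of_maps_to_of_nsmul_le_sum
    (s := (univ : Finset (Fin m → Fin n))) (t := T) (f := prof) (w := F) (b := S ^ m / T.card)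
    (fun w _ => mem_image_of_mem prof (mem_univ w)) hTne
    (by rw [hsumF, nsmul_eq_mul, mul_div_cancel₀ _ hTpos.ne'])
  -- the heaviest class beats `P^m`
  have hclass : P ^ m < ∑ w ∈ univ.filter (fun w => prof w = y), F w := by
    refine lt_of_lt_of_le ?_ hy
    rw [lt_div_iff₀ hTpos]
    have hSm : S ^ m = (S / P) ^ m * P ^ m := by
      rw [div_pow, div_mul_cancel₀ _ (pow_ne_zero _ hP0.ne')]
    rw [hSm]
    have hPm : 0 < P ^ m := pow_pos hP0 m
    have hT' : (T.card : ℝ) ≤ ((m : ℝ) + 1) ^ n := by exact_mod_cast hTcard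
    nlinarith
  -- reindex the class along `Fin n'`
  set Wy : Finset (Fin m → Fin n) := univ.filter (fun w => prof w = y) with hWy
  set n' : ℕ := Wy.card with hn'
  set e : Fin n' ≃ Wy := (Wy.equivFin).symm with he
  set f : Fin n' → (Fin m → Fin n) := fun i => ((e i : Wy) : Fin m → Fin n) with hf
  have hfinj : Function.Injective f :=
    Subtype.val_injective.comp e.injective
  have hfmem : ∀ i, prof (f i) = y := fun i => (mem_filter.1 (e i).2).2
  refine ⟨K * m, n', y.1, y.2.1, y.2.2, Am ∘ f, Bm ∘ f, Cm ∘ f,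
    (isSTPP_iff_addSimultaneousTPP _ _ _).2 (hSm.comp hfinj), ?_, ?_⟩
  · intro i
    have h1 := hfmem i
    simp only [hprof, Prod.ext_iff] at h1
    simp only [Function.comp_apply, (hcard (f i)).1, (hcard (f i)).2.1, (hcard (f i)).2.2]
    exact h1
  · -- the class sum, as a sum over `Fin n'`, is `n' · (abc)^τ` and exceeds `p^(K m) = P^m`
    have hsum : ∑ i : Fin n', F (f i) = ∑ w ∈ Wy, F w := by
      rw [← Finset.sum_coe_sort Wy]
      exact e.sum_comp (fun w : Wy => F (w : Fin m → Fin n))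
    have hconst : ∀ i : Fin n', F (f i) = ((y.1 * y.2.1 * y.2.2 : ℕ) : ℝ) ^ τ := by
      intro i
      have h1 := hfmem i
      simp only [hprof, Prod.ext_iff] at h1
      simp only [hF, (hcard (f i)).1, (hcard (f i)).2.1, (hcard (f i)).2.2]
      rw [h1.1, h1.2.1, h1.2.2]
    have hsum' : ∑ i : Fin n', F (f i) = n' * ((y.1 * y.2.1 * y.2.2 : ℕ) : ℝ) ^ τ := by
      rw [Finset.sum_congr rfl fun i _ => hconst i, sum_const, card_univ, Fintype.card_fin,
        nsmul_eq_mul]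
    rw [pow_mul, ← hsum', hsum]
    exact hclass

/-! ### Symmetrisation -/

/-- **Symmetrisation.** A finite STPP design in `ℤ/(p^K)` with one size profile `(a, b, c)`
beating its host at exponent `τ` yields a UNIFORM one (all blocks of size `M = abc`) in
`ℤ/(p^(3K))` beating its host: concatenate the design with its two role rotations
(`stub_tripleConcat`, `isSTPP_rotate`); ratios multiply. [folklore] -/
theorem exists_uniform_of_oneProfile (p K n a b c : ℕ) (hp : 0 < p)
    (A B C : Fin n → Finset (ZMod (p ^ K))) (hS : IsSTPP A B C)
    (hcard : ∀ i, (A i).card = a ∧ (B i).card = b ∧ (C i).card = c) (τ : ℝ)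
    (hbeat : (p : ℝ) ^ K < n * ((a * b * c : ℕ) : ℝ) ^ τ) :
    ∃ (K' n' M : ℕ) (A' B' C' : Fin n' → Finset (ZMod (p ^ K'))),
      IsSTPP A' B' C' ∧ (∀ i, (A' i).card = M ∧ (B' i).card = M ∧ (C' i).card = M) ∧
        (p : ℝ) ^ K' < n' * ((M : ℝ) ^ 3) ^ τ := by
  obtain ⟨D₁, D₂, D₃, hD, hDcard⟩ := stub_tripleConcat p K K K n n n hp A B C B C A C A B hS
    (isSTPP_rotate hS) (isSTPP_rotate (isSTPP_rotate hS))
  -- reindex along `Fin (n * (n * n)) ≃ Fin n × Fin n × Fin n`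
  set e : Fin (n * (n * n)) ≃ Fin n × Fin n × Fin n :=
    (((Equiv.refl (Fin n)).prodCongr finProdFinEquiv).trans finProdFinEquiv).symm with he
  refine ⟨K + K + K, n * (n * n), a * b * c, D₁ ∘ e, D₂ ∘ e, D₃ ∘ e,
    (isSTPP_iff_addSimultaneousTPP _ _ _).2 (hD.comp e.injective), ?_, ?_⟩
  · intro i
    obtain ⟨h1, h2, h3⟩ := hDcard (e i)
    simp only [Function.comp_apply, h1, h2, h3, (hcard _).1, (hcard _).2.1, (hcard _).2.2]
    refine ⟨trivial, by ring, by ring⟩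
  · have hP0 : (0 : ℝ) ≤ (p : ℝ) ^ K := by positivity
    have hx0 : (0 : ℝ) ≤ ((a * b * c : ℕ) : ℝ) := Nat.cast_nonneg _
    have h3 : ((p : ℝ) ^ K) ^ 3 < ((n : ℝ) * ((a * b * c : ℕ) : ℝ) ^ τ) ^ 3 :=
      pow_lt_pow_left₀ hbeat hP0 (by norm_num)
    have hM : (((a * b * c : ℕ) : ℝ) ^ 3) ^ τ = (((a * b * c : ℕ) : ℝ) ^ τ) ^ 3 :=
      (Real.rpow_pow_comm hx0 τ 3).symm
    calc (p : ℝ) ^ (K + K + K) = ((p : ℝ) ^ K) ^ 3 := by ring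
      _ < ((n : ℝ) * ((a * b * c : ℕ) : ℝ) ^ τ) ^ 3 := h3
      _ = ((n * (n * n) : ℕ) : ℝ) * (((a * b * c : ℕ) : ℝ) ^ 3) ^ τ := by
          rw [hM]; push_cast; ring

/-- **Uniform blocks have size at least `2`.** If a design all of whose blocks have size `M` beats
its host at an exponent `τ > 0`, then `M ≥ 2`: `M = 0` gives packing sum `0`, and for `M = 1` the
packing bound `∑ᵢ |Aᵢ||Bᵢ| ≤ |ℤ/(p^K)|` (Blasiak et al. 2017, §2; tree
`AddSimultaneousTPP.sum_card_mul_card_le`) gives `n ≤ p^K`.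
[cite: BlasiakChurchCohnGrochowNaslundSawinUmans2017, §2] -/
theorem two_le_of_uniform_beat (p K n M : ℕ) (hp : 0 < p) (A B C : Fin n → Finset (ZMod (p ^ K)))
    (hS : IsSTPP A B C) (hcard : ∀ i, (A i).card = M ∧ (B i).card = M ∧ (C i).card = M)
    (τ : ℝ) (hτ : 0 < τ) (hbeat : (p : ℝ) ^ K < n * ((M : ℝ) ^ 3) ^ τ) : 2 ≤ M := by
  classical
  haveI : NeZero (p ^ K) := ⟨pow_ne_zero _ hp.ne'⟩
  by_contra hM
  push Not at hM
  interval_cases M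
  · -- `M = 0`
    simp only [CharP.cast_eq_zero, ne_eq, OfNat.ofNat_ne_zero, not_false_eq_true, zero_pow,
      Real.zero_rpow hτ.ne', mul_zero] at hbeat
    exact absurd hbeat (not_lt.2 (by positivity))
  · -- `M = 1`: the packing bound
    have hpack := AddSimultaneousTPP.sum_card_mul_card_le
      ((isSTPP_iff_addSimultaneousTPP _ _ _).1 hS)
      (fun i => Finset.card_pos.1 (by rw [(hcard i).2.2]; exact Nat.one_pos))
    have hn : n ≤ p ^ K := by
      have : ∑ i : Fin n, (A i).card * (B i).card = n := by
        simp [(hcard _).1, (hcard _).2.1]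
      rw [this, ZMod.card] at hpack
      exact hpack
    simp only [Nat.cast_one, one_pow, Real.one_rpow, mul_one] at hbeat
    exact absurd (hbeat.trans_le (by exact_mod_cast hn)) (lt_irrefl _)

/-! ### The uniform normal form -/

/-- **Uniform witnesses from cyclic witnesses.** For `τ > 2/3`, a finite cyclic STPP design beating
its host at exponent `τ` (the normal form `CyclicBeat` at `τ`) yields a UNIFORM one: all `3n`
blocks of size `M ≥ 2`, host `ℤ/(p^K)`, `p ≥ 2`, and `p^K < n · (M³)^τ`. [folklore] -/
theorem uniformBeat_of_cyclicBeat {τ : ℝ} (hτ : 2 / 3 < τ)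
    (h : ∃ (p K n : ℕ) (_ : 2 ≤ p) (A B C : Fin n → Finset (ZMod (p ^ K))),
      IsSTPP A B C ∧ (p : ℝ) ^ K < ∑ i, (((A i).card * (B i).card * (C i).card : ℕ) : ℝ) ^ τ) :
    ∃ (p K n M : ℕ) (_ : 2 ≤ p) (_ : 2 ≤ M) (A B C : Fin n → Finset (ZMod (p ^ K))),
      IsSTPP A B C ∧ (∀ i, (A i).card = M ∧ (B i).card = M ∧ (C i).card = M) ∧
        (p : ℝ) ^ K < n * ((M : ℝ) ^ 3) ^ τ := by
  obtain ⟨p, K, n, hp, A, B, C, hS, hbeat⟩ := h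
  have hp0 : 0 < p := by omega
  obtain ⟨K₁, n₁, a, b, c, A₁, B₁, C₁, hS₁, hcard₁, hbeat₁⟩ :=
    exists_oneProfile_of_beat p K n hp0 A B C hS τ hbeat
  obtain ⟨K₂, n₂, M, A₂, B₂, C₂, hS₂, hcard₂, hbeat₂⟩ :=
    exists_uniform_of_oneProfile p K₁ n₁ a b c hp0 A₁ B₁ C₁ hS₁ hcard₁ τ hbeat₁
  exact ⟨p, K₂, n₂, M, hp, two_le_of_uniform_beat p K₂ n₂ M hp0 A₂ B₂ C₂ hS₂ hcard₂ τ
    (by linarith) hbeat₂, A₂, B₂, C₂, hS₂, hcard₂, hbeat₂⟩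

/-- **Uniform witnesses are witnesses**: the packing sum of a uniform design is `n · (M³)^τ`.
[folklore] -/
theorem cyclicBeat_of_uniformBeat {τ : ℝ}
    (h : ∃ (p K n M : ℕ) (_ : 2 ≤ p) (_ : 2 ≤ M) (A B C : Fin n → Finset (ZMod (p ^ K))),
      IsSTPP A B C ∧ (∀ i, (A i).card = M ∧ (B i).card = M ∧ (C i).card = M) ∧
        (p : ℝ) ^ K < n * ((M : ℝ) ^ 3) ^ τ) :
    ∃ (p K n : ℕ) (_ : 2 ≤ p) (A B C : Fin n → Finset (ZMod (p ^ K))),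
      IsSTPP A B C ∧ (p : ℝ) ^ K < ∑ i, (((A i).card * (B i).card * (C i).card : ℕ) : ℝ) ^ τ := by
  obtain ⟨p, K, n, M, hp, -, A, B, C, hS, hcard, hbeat⟩ := h
  refine ⟨p, K, n, hp, A, B, C, hS, ?_⟩
  have hsum : ∑ i, (((A i).card * (B i).card * (C i).card : ℕ) : ℝ) ^ τ =
      n * ((M : ℝ) ^ 3) ^ τ := by
    rw [Finset.sum_congr rfl fun i _ => by rw [(hcard i).1, (hcard i).2.1, (hcard i).2.2],
      sum_const, card_univ, Fintype.card_fin, nsmul_eq_mul]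
    push_cast
    ring_nf
  rwa [hsum]

/-- **Uniform normal form of the crux.** `AutomaticPackingThesis` holds iff for every `τ > 2/3`
some STPP design in some `ℤ/(p^K)` (`p ≥ 2`), all of whose blocks have the same size `M ≥ 2`,
beats its host: `p^K < n · (M³)^τ`. [folklore] -/
theorem automaticPackingThesis_iff_uniformBeat :
    AutomaticPackingThesis ↔
      ∀ τ : ℝ, 2 / 3 < τ → ∃ (p K n M : ℕ) (_ : 2 ≤ p) (_ : 2 ≤ M)
        (A B C : Fin n → Finset (ZMod (p ^ K))),
        IsSTPP A B C ∧ (∀ i, (A i).card = M ∧ (B i).card = M ∧ (C i).card = M) ∧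
          (p : ℝ) ^ K < n * ((M : ℝ) ^ 3) ^ τ := by
  rw [automaticPackingThesis_iff_cyclicBeat]
  exact ⟨fun h τ hτ => uniformBeat_of_cyclicBeat hτ (h τ hτ),
    fun h τ hτ => cyclicBeat_of_uniformBeat (h τ hτ)⟩

/-- **Efficiency reading.** A uniform witness at exponent `τ` packs its `n` triples of `M`-blocks
with efficiency `η = n M² / p^K > M^(2 - 3τ)` (the three classical packing bounds say `η ≤ 1`;
`τ ↓ 2/3` means `η > M^(-δ)` with `δ ↓ 0`). [folklore] -/
theorem uniformBeat_efficiency {p K n M : ℕ} (hM : 2 ≤ M) {τ : ℝ}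
    (hbeat : (p : ℝ) ^ K < n * ((M : ℝ) ^ 3) ^ τ) (hp : 0 < p) :
    (M : ℝ) ^ (2 - 3 * τ) < n * (M : ℝ) ^ 2 / (p : ℝ) ^ K := by
  have hM0 : (0 : ℝ) < M := by exact_mod_cast (by omega : 0 < M)
  have hP0 : (0 : ℝ) < (p : ℝ) ^ K := by positivity
  have h3τ : ((M : ℝ) ^ 3) ^ τ = (M : ℝ) ^ (3 * τ) := by
    rw [← Real.rpow_natCast _ 3, ← Real.rpow_mul hM0.le]
    norm_num
  rw [h3τ] at hbeat
  rw [Real.rpow_sub hM0, Real.rpow_two, lt_div_iff₀ hP0, div_mul_eq_mul_div,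
    div_lt_iff₀ (Real.rpow_pos_of_pos hM0 _)]
  calc (M : ℝ) ^ 2 * (p : ℝ) ^ K < (M : ℝ) ^ 2 * (n * (M : ℝ) ^ (3 * τ)) := by
        exact mul_lt_mul_of_pos_left hbeat (by positivity)
    _ = n * (M : ℝ) ^ 2 * (M : ℝ) ^ (3 * τ) := by ring

/-- Registered stub `stub_uniformNormalForm` of crux stmt-MatrixMultiplication-7356 (line `Sketch`,
lead c2): the uniform normal form, verbatim `automaticPackingThesis_iff_uniformBeat`. [folklore] -/
theorem stub_uniformNormalForm :
    AutomaticPackingThesis ↔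
      ∀ τ : ℝ, 2 / 3 < τ → ∃ (p K n M : ℕ) (_ : 2 ≤ p) (_ : 2 ≤ M)
        (A B C : Fin n → Finset (ZMod (p ^ K))),
        IsSTPP A B C ∧ (∀ i, (A i).card = M ∧ (B i).card = M ∧ (C i).card = M) ∧
          (p : ℝ) ^ K < n * ((M : ℝ) ^ 3) ^ τ :=
  automaticPackingThesis_iff_uniformBeat

end AutomaticPackingThesis

end Summit.MatrixMultiplication.MatrixMultiplication.Theorems

end
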